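import Literature.NumberTheory.QuadraticFields.IdealClassWeightedLatticeSum
import HarnessLib

/-!
# The form–ideal dictionary, coordinate-free: `Σ_{[𝔞] = [𝔟]⁻¹} f(N𝔞) = ½ Σ_{α ∈ 𝔟} f(N(α)/N𝔟)`
# for ANY nonzero integral ideal `𝔟` of an imaginary quadratic field with `d_K < −4`

Topic `NumberTheory/QuadraticFields`, namespace `Literature.NumberTheory.QuadraticFields.Quadratic`
(continuing `IdealClassWeightedLatticeSum.lean`, which treats the lattice ideals `𝔟 = (A, ω − k)`
of binary forms in the coordinates `α = xA + y(ω − k)`). Everything here is PROVED (theorems only,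
no definitions, no named facts).

For an imaginary quadratic field `K` with `d_K < −4` (`[K:ℚ] = 2`; the only units are `±1`) and a
nonzero integral ideal `𝔟`, the map `α ↦ 𝔞 = (α)𝔟⁻¹` from `𝔟 ∖ 0` to the integral ideals `𝔞`
with `𝔟𝔞` principal — the integral ideals of the class `[𝔟]⁻¹` — is two-to-one (`(α) = (α') ⇔
α' = ±α`), with `N𝔞 = |N(α)|/N𝔟`. Hence, for every weight `f : ℕ → ℂ` with `f 0 = 0` and
`Σ_{α ∈ 𝔟} |f(|N(α)|/N𝔟)| < ∞`:

* `hasSum_ideal_mul_isPrincipal_weight_of_ideal` —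
  **`Σ_{𝔞 : 𝔟𝔞 principal} f(N𝔞) = ½ Σ_{α ∈ 𝔟} f(|N(α)|/N𝔟)`** (a `HasSum` over the ideals `𝔞` with
  `𝔟𝔞` principal, `𝔞 = 0` contributing `f 0 = 0`; the right side a `tsum` over the elements of `𝔟`);
  `tsum_ideal_mul_isPrincipal_eq_half_tsum_of_ideal` is the `tsum` form.

This is the same dictionary as `hasSum_ideal_mul_isPrincipal_weight` (Cox, Thm. 7.7; Zagier §8
"`ζ(s, A) = (1/w) Σ'_{x,y} Q(x,y)^{−s}`"; Conrey–Iwaniec (2.14)–(2.15)) but WITHOUT a choice of basis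
of `𝔟`: any `ℤ`-basis of `𝔟` then yields a binary theta/Epstein series. It is the form needed when
the lattice arises intrinsically — e.g. the index-`s` sublattices `𝔰𝔟` (`𝔰² = (s)`, `s ∣ d_K`) met
in the transformation of class theta series at the cusps `a/c`, `(c, |d_K|) = s`.

## References

* [Cox2013] D. A. Cox, *Primes of the form x² + ny²*, 2nd ed. (2013), §7.B Thm. 7.7.
* [Zagier1981] D. B. Zagier, *Zetafunktionen und quadratische Körper* (1981), §8.
* [ConreyIwaniec2002] B. Conrey, H. Iwaniec, Acta Arith. 103 (2002) 259–312, §2 (2.14)–(2.15).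
-/

noncomputable section

open Module NumberField Ideal Complex

namespace Literature.NumberTheory.QuadraticFields.Quadratic

variable {K : Type*} [Field K] [NumberField K]

/-- **The class-sum identity for an arbitrary weight, coordinate-free**: for an imaginary quadratic
field `K` (`[K:ℚ] = 2`, `d_K < −4`), a nonzero integral ideal `𝔟`, and any `f : ℕ → ℂ` with
`f 0 = 0` and `Σ_{α ∈ 𝔟} |f(|N(α)|/N𝔟)| < ∞`:
`Σ_{𝔞 : 𝔟𝔞 principal} f(N𝔞) = ½ Σ_{α ∈ 𝔟} f(|N(α)|/N𝔟)`.
Proof: `α ↦ 𝔞` with `(α) = 𝔟𝔞` is two-to-one off `0` (`(α) = (α') ⇔ α' = ±α`, the units being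
`±1` as `d_K < −4`) onto the `𝔞` with `𝔟𝔞` principal, and `N(α) = N𝔟 · N𝔞`. The case
`𝔟 = (A, ω − k)`, `α = xA + y(ω − k)`, `|N(α)|/N𝔟 = Q(x,y)` is `hasSum_ideal_mul_isPrincipal_weight`;
Cox, Thm. 7.7 / Zagier §8 (`f(n) = n^{−s}`). [cite: Cox2013, §7.B Thm. 7.7] -/
theorem hasSum_ideal_mul_isPrincipal_weight_of_ideal (h2 : finrank ℚ K = 2)
    (hd : NumberField.discr K < -4) {𝔟 : Ideal (𝓞 K)} (h𝔟0 : 𝔟 ≠ ⊥)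
    {f : ℕ → ℂ} (hf0 : f 0 = 0)
    (hf : Summable fun α : 𝔟 => f ((Algebra.norm ℤ (α : 𝓞 K)).natAbs / absNorm 𝔟)) :
    HasSum (fun J : {J : Ideal (𝓞 K) // (𝔟 * J).IsPrincipal} => f (absNorm J.1))
      (1 / 2 * ∑' α : 𝔟, f ((Algebra.norm ℤ (α : 𝓞 K)).natAbs / absNorm 𝔟)) := by
  classical
  -- coordinates `d_K = t² + 4m` (for the unit count `±1`)
  obtain ⟨b, hb⟩ := exists_basis_zero_eq_one h2
  have hω := basis_one_mul_self_eq b hb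
  have hdisc := discr_eq_sq_add_four_mul b hb
  have hD : (b.repr (b 1 * b 1) 1) ^ 2 + 4 * b.repr (b 1 * b 1) 0 < -4 := hdisc ▸ hd
  have h𝔟N0 : absNorm 𝔟 ≠ 0 := by
    rw [Ne, Ideal.absNorm_eq_zero_iff]; exact h𝔟0
  -- (1) the cofactor ideal `J(α)`: `(α) = 𝔟 · J(α)`
  have hdvd : ∀ α : 𝔟, 𝔟 ∣ span {(α : 𝓞 K)} := fun α =>
    Ideal.dvd_iff_le.mpr ((Ideal.span_singleton_le_iff_mem _).mpr α.2)
  set Jof : 𝔟 → Ideal (𝓞 K) := fun α => Classical.choose (hdvd α) with hJof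
  have hJof_spec : ∀ α : 𝔟, span {(α : 𝓞 K)} = 𝔟 * Jof α := fun α => Classical.choose_spec (hdvd α)
  have hJof_uniq : ∀ (α : 𝔟) (J : Ideal (𝓞 K)), span {(α : 𝓞 K)} = 𝔟 * J → J = Jof α := by
    intro α J hJ
    have : 𝔟 * J = 𝔟 * Jof α := hJ.symm.trans (hJof_spec α)
    exact mul_left_cancel₀ (show 𝔟 ≠ 0 from h𝔟0) this
  -- `J(α) = J(α') ↔ α' = ±α`
  have hJof_eq_iff : ∀ α α' : 𝔟, Jof α = Jof α' ↔ (α' = α ∨ α' = -α) := by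
    intro α α'
    constructor
    · intro h
      have this : span {(α : 𝓞 K)} = span {(α' : 𝓞 K)} := by rw [hJof_spec α, hJof_spec α', h]
      rcases (span_singleton_eq_span_singleton_iff' b hb hω hD _ _).1 this with h' | h'
      · exact Or.inl (Subtype.ext h')
      · refine Or.inr (Subtype.ext ?_)
        rw [Submodule.coe_neg]
        exact h'
    · rintro (rfl | rfl)
      · rfl
      · refine hJof_uniq (-α) (Jof α) ?_
        rw [Submodule.coe_neg, Ideal.span_singleton_neg]
        exact hJof_spec α
  -- the norm of `J(α)` is `|N(α)| / N𝔟`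
  have hnormJ : ∀ α : 𝔟, absNorm (Jof α) = (Algebra.norm ℤ (α : 𝓞 K)).natAbs / absNorm 𝔟 := by
    intro α
    have h1 := congrArg absNorm (hJof_spec α)
    rw [map_mul, Ideal.absNorm_span_singleton] at h1
    rw [h1, Nat.mul_div_cancel_left _ (Nat.pos_of_ne_zero h𝔟N0)]
  -- (2) the summand
  set G : Ideal (𝓞 K) → ℂ := fun I => f (absNorm I) with hG
  set F : 𝔟 → ℂ := fun α => G (Jof α) with hF
  have hG_bot : G ⊥ = 0 := by
    simp only [hG, Ideal.absNorm_bot, hf0]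
  have hterm : ∀ α : 𝔟, f ((Algebra.norm ℤ (α : 𝓞 K)).natAbs / absNorm 𝔟) = F α := by
    intro α
    simp only [hF, hG, hnormJ]
  have hsumF : Summable F := hf.congr hterm
  have hZ : (∑' α : 𝔟, f ((Algebra.norm ℤ (α : 𝓞 K)).natAbs / absNorm 𝔟)) = ∑' α : 𝔟, F α :=
    tsum_congr hterm
  -- (3) the fibres of `J`: `{±α₀}` over the ideals `I` with `𝔟I` principal, `∅` otherwise
  have hfib := hsumF.hasSum.tsum_fiberwise Jof
  have hinner : ∀ I : Ideal (𝓞 K), (∑' α : ↥(Jof ⁻¹' {I}), F α) =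
      Set.indicator {I | (𝔟 * I).IsPrincipal} (fun I => 2 * G I) I := by
    intro I
    by_cases hI : (𝔟 * I).IsPrincipal
    · rw [Set.indicator_of_mem (show I ∈ {I | (𝔟 * I).IsPrincipal} from hI)]
      obtain ⟨β, hβ⟩ : ∃ β : 𝓞 K, 𝔟 * I = span {β} := ⟨_, hI.span_singleton_generator.symm⟩
      have hβmem : β ∈ 𝔟 := by
        have : β ∈ 𝔟 * I := by rw [hβ]; exact Ideal.mem_span_singleton_self β
        exact Ideal.mul_le_right this
      set α₀ : 𝔟 := ⟨β, hβmem⟩ with hα₀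
      have hJα₀ : Jof α₀ = I := (hJof_uniq α₀ I hβ.symm).symm
      have hset : (Jof ⁻¹' {I}) = {α₀, -α₀} := by
        ext α
        simp only [Set.mem_preimage, Set.mem_singleton_iff, Set.mem_insert_iff]
        rw [← hJα₀, eq_comm, hJof_eq_iff α₀ α]
      rw [tsum_subtype (Jof ⁻¹' {I}) F, hset]
      by_cases hβ0 : β = 0
      · have hI0 : I = ⊥ := by
          have : 𝔟 * I = ⊥ := by rw [hβ, hβ0]; simp
          exact (Ideal.mul_eq_bot.mp this).resolve_left h𝔟0
        have hα00 : α₀ = 0 := Subtype.ext hβ0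
        rw [hα00, neg_zero, Set.pair_eq_singleton, tsum_eq_single 0 (fun α hα =>
          Set.indicator_of_notMem (by simpa using hα) F), Set.indicator_of_mem (Set.mem_singleton _)]
        rw [← hα00]
        show G (Jof α₀) = 2 * G I
        rw [hJα₀, hI0, hG_bot, mul_zero]
      · have hne : α₀ ≠ -α₀ := by
          intro h
          have h' : (β : 𝓞 K) = -β := congrArg Subtype.val h
          have : (2 : 𝓞 K) * β = 0 := by linear_combination h'
          exact hβ0 ((mul_eq_zero.mp this).resolve_left (by norm_num))
        rw [tsum_eq_sum (s := {α₀, -α₀}) (fun α hα => Set.indicator_of_notMem (by simpa using hα) F),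
          Finset.sum_pair hne, Set.indicator_of_mem (by simp), Set.indicator_of_mem (by simp)]
        have hJneg : Jof (-α₀) = I := by
          rw [← (hJof_eq_iff α₀ (-α₀)).2 (Or.inr rfl)]
          exact hJα₀
        have h1 : F α₀ = G I := by
          show G (Jof α₀) = G I
          rw [hJα₀]
        have h2 : F (-α₀) = G I := by
          show G (Jof (-α₀)) = G I
          rw [hJneg]
        rw [h1, h2]
        ring
    · rw [Set.indicator_of_notMem (show I ∉ {I | (𝔟 * I).IsPrincipal} from hI)]
      have hempty : (Jof ⁻¹' {I}) = ∅ := by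
        ext α
        simp only [Set.mem_preimage, Set.mem_singleton_iff, Set.mem_empty_iff_false, iff_false]
        intro h
        apply hI
        rw [← h, ← hJof_spec α]
        exact ⟨⟨α, rfl⟩⟩
      rw [tsum_subtype (Jof ⁻¹' {I}) F, hempty]
      simp
  have hfib' : HasSum (Set.indicator {I | (𝔟 * I).IsPrincipal} (fun I => 2 * G I))
      (∑' α : 𝔟, F α) := by
    have hfun : (fun I : Ideal (𝓞 K) => ∑' α : ↥(Jof ⁻¹' {I}), F α) =
        Set.indicator {I | (𝔟 * I).IsPrincipal} (fun I => 2 * G I) := funext hinner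
    rw [← hfun]
    exact hfib
  -- (4) pass to the subtype and divide by `2`
  have hsub : HasSum (fun J : {J : Ideal (𝓞 K) // (𝔟 * J).IsPrincipal} => 2 * G J.1)
      (∑' α : 𝔟, F α) :=
    (hasSum_subtype_iff_indicator (f := fun I : Ideal (𝓞 K) => 2 * G I)
      (s := {I | (𝔟 * I).IsPrincipal})).mpr hfib'
  have h3 := hsub.mul_left (1 / 2 : ℂ)
  have hfun : (fun J : {J : Ideal (𝓞 K) // (𝔟 * J).IsPrincipal} => (1 / 2 : ℂ) * (2 * G J.1)) =
      fun J => G J.1 := by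
    funext J
    ring
  rw [hfun, ← hZ] at h3
  exact h3

/-- **`tsum` form of the coordinate-free class-sum identity**:
`Σ'_{𝔞 : 𝔟𝔞 principal} f(N𝔞) = ½ Σ'_{α ∈ 𝔟} f(|N(α)|/N𝔟)` (hypotheses as in
`hasSum_ideal_mul_isPrincipal_weight_of_ideal`). [cite: Cox2013, §7.B Thm. 7.7] -/
theorem tsum_ideal_mul_isPrincipal_eq_half_tsum_of_ideal (h2 : finrank ℚ K = 2)
    (hd : NumberField.discr K < -4) {𝔟 : Ideal (𝓞 K)} (h𝔟0 : 𝔟 ≠ ⊥)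
    {f : ℕ → ℂ} (hf0 : f 0 = 0)
    (hf : Summable fun α : 𝔟 => f ((Algebra.norm ℤ (α : 𝓞 K)).natAbs / absNorm 𝔟)) :
    ∑' J : {J : Ideal (𝓞 K) // (𝔟 * J).IsPrincipal}, f (absNorm J.1) =
      1 / 2 * ∑' α : 𝔟, f ((Algebra.norm ℤ (α : 𝓞 K)).natAbs / absNorm 𝔟) :=
  (hasSum_ideal_mul_isPrincipal_weight_of_ideal h2 hd h𝔟0 hf0 hf).tsum_eq

/-- **The coordinate-free class-sum identity as a sum over all ideals** (terms outside the class
`[𝔟]⁻¹` set to `0`): `Σ_𝔞 𝟙[𝔟𝔞 principal] f(N𝔞) = ½ Σ_{α ∈ 𝔟} f(|N(α)|/N𝔟)`.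
[cite: Cox2013, §7.B Thm. 7.7] -/
theorem hasSum_indicator_ideal_mul_isPrincipal_weight_of_ideal (h2 : finrank ℚ K = 2)
    (hd : NumberField.discr K < -4) {𝔟 : Ideal (𝓞 K)} (h𝔟0 : 𝔟 ≠ ⊥)
    {f : ℕ → ℂ} (hf0 : f 0 = 0)
    (hf : Summable fun α : 𝔟 => f ((Algebra.norm ℤ (α : 𝓞 K)).natAbs / absNorm 𝔟)) :
    HasSum (Set.indicator {J : Ideal (𝓞 K) | (𝔟 * J).IsPrincipal} (fun J => f (absNorm J)))
      (1 / 2 * ∑' α : 𝔟, f ((Algebra.norm ℤ (α : 𝓞 K)).natAbs / absNorm 𝔟)) :=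
  (hasSum_subtype_iff_indicator (f := fun J : Ideal (𝓞 K) => f (absNorm J))
    (s := {J : Ideal (𝓞 K) | (𝔟 * J).IsPrincipal})).mp
    (hasSum_ideal_mul_isPrincipal_weight_of_ideal h2 hd h𝔟0 hf0 hf)

end Literature.NumberTheory.QuadraticFields.Quadratic

end
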